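import Summits.AtomisticToContinuum.HydrodynamicLimit.Theses.MourreKoopmanCharges
import HarnessLib

/-!
# `StressStrongMixing` · line `birth`, stub C1: necessary conditions carried by an integrable spectral density

Support file for the crux item stmt-AtomisticToContinuum-9584 (`StressStrongMixing`, route `MourreKoopmanCharges` of
`AtomisticToContinuum/HydrodynamicLimit`), line `birth`.  The registered open stub C1 `stub_stressSpectralDensity` asserts
that the stress autocorrelation `c(s) = ⟪U_s ξ_Π, ξ_Π⟫_ℋ` of every density-one framework is the cosine transform of an
INTEGRABLE density, `c(s) = ∫ cos(sλ) ρ(λ) dλ`.  Two consequences that any attack on C1 (or any future proof) must respect,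
proved here for the Koopman group of an arbitrary fluctuation dynamics `D` and an arbitrary vector `ψ`:

* `continuous_integral_cos_mul` — a cosine transform of an integrable density is continuous (dominated convergence);
* `tendsto_koopman_of_inner_eq_integral_cos` — hence, if `⟪U_s ψ, ψ⟫ = ∫ cos(sλ) ρ(λ) dλ` with `ρ ∈ L¹`, the orbit
  `s ↦ U_s ψ` is STRONGLY CONTINUOUS (`‖U_s ψ - U_t ψ‖² = 2 (c(0) - c(s - t))` on the real space `ℋ`): C1 contains the
  strong continuity of the Koopman orbit of the stress class, which the hypothesis structure `HardSphereFluctuationData`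
  does not provide (FluctuationSpace.lean, "strong continuity … not asserted").

References: W. Rudin, *Fourier Analysis on Groups*, §1.2.4 and §1.4.3; B. Doyon, CMP 391 (2022), Def. 4.8 / Thm 4.11 (III).
-/

noncomputable section

open MeasureTheory ProbabilityTheory Filter Topology
open scoped InnerProductSpace ENNReal

namespace Summit.AtomisticToContinuum.HydrodynamicLimit.Theorems.MourreKoopmanChargesStressStrongMixing

open Literature.MathematicalPhysics.KineticTheory Literature.Analysis.FluidPDE

/-- **A cosine transform of an integrable density is continuous** (dominated convergence, bound `|ρ|`). [folklore] -/
theorem continuous_integral_cos_mul {ρ : ℝ → ℝ} (hρ : Integrable ρ) :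
    Continuous fun s : ℝ => ∫ l, Real.cos (s * l) * ρ l := by
  refine continuous_of_dominated (bound := fun l => |ρ l|) ?_ ?_ hρ.abs ?_
  · intro s
    exact ((by fun_prop : Measurable fun l : ℝ => Real.cos (s * l)).aestronglyMeasurable).mul hρ.aestronglyMeasurable
  · intro s
    refine Eventually.of_forall fun l => ?_
    rw [Real.norm_eq_abs, abs_mul]
    exact mul_le_of_le_one_left (abs_nonneg _) (Real.abs_cos_le_one _)
  · refine Eventually.of_forall fun l => ?_
    exact ((Real.continuous_cos.comp (continuous_id.mul continuous_const)).mul continuous_const)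

section Orbit

variable {G Ω : Type*} [AddCommGroup G] [MeasurableSpace G] [MeasurableSpace Ω] {ν : Measure G}
  {T : ShiftAction G Ω} [MeasurableNeg G] [ν.IsNegInvariant] (D : FluctuationDynamics ν T)

/-- **Orbit increments are controlled by the autocorrelation** on the real Hilbert space `ℋ`:
`‖U_s ψ - U_t ψ‖² = 2 (⟪U_0 ψ, ψ⟫ - ⟪U_{s-t} ψ, ψ⟫)`. [folklore] -/
theorem norm_koopman_sub_koopman_sq (s t : ℝ) (ψ : D.FluctuationSpace) :
    ‖D.koopman s ψ - D.koopman t ψ‖ ^ 2 = 2 * (⟪D.koopman 0 ψ, ψ⟫_ℝ - ⟪D.koopman (s - t) ψ, ψ⟫_ℝ) := by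
  have hst : ⟪D.koopman s ψ, D.koopman t ψ⟫_ℝ = ⟪D.koopman (s - t) ψ, ψ⟫_ℝ := by
    have h := D.inner_koopman_koopman (-t) (D.koopman s ψ) (D.koopman t ψ)
    rw [← D.koopman_add_apply, ← D.koopman_add_apply, neg_add_cancel, D.koopman_zero_apply, neg_add_eq_sub] at h
    exact h.symm
  rw [@norm_sub_sq_real, LinearIsometryEquiv.norm_map, LinearIsometryEquiv.norm_map, hst, D.koopman_zero_apply,
    real_inner_self_eq_norm_sq]
  ring

/-- **An integrable spectral density forces a strongly continuous orbit**: if `⟪U_s ψ, ψ⟫ = ∫ cos(sλ) ρ(λ) dλ` for all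
`s` with `ρ ∈ L¹(ℝ)`, then `s ↦ U_s ψ` is continuous. [folklore] -/
theorem continuous_koopman_of_inner_eq_integral_cos (ψ : D.FluctuationSpace) {ρ : ℝ → ℝ} (hρ : Integrable ρ)
    (hrepr : ∀ s : ℝ, ⟪D.koopman s ψ, ψ⟫_ℝ = ∫ l, Real.cos (s * l) * ρ l) :
    Continuous fun s : ℝ => D.koopman s ψ := by
  have hc : Continuous fun s : ℝ => ⟪D.koopman s ψ, ψ⟫_ℝ := by
    have e : (fun s : ℝ => ⟪D.koopman s ψ, ψ⟫_ℝ) = fun s => ∫ l, Real.cos (s * l) * ρ l := funext hrepr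
    rw [e]
    exact continuous_integral_cos_mul hρ
  rw [Metric.continuous_iff]
  intro t ε hε
  -- continuity of `u ↦ ⟪U_u ψ, ψ⟫` at `0`, applied to `u = s - t`
  have h0 : Tendsto (fun s : ℝ => ⟪D.koopman (s - t) ψ, ψ⟫_ℝ) (𝓝 t) (𝓝 ⟪D.koopman 0 ψ, ψ⟫_ℝ) := by
    have := hc.tendsto 0
    have hsub : Tendsto (fun s : ℝ => s - t) (𝓝 t) (𝓝 0) := by
      rw [show (0 : ℝ) = t - t from (sub_self t).symm]
      exact tendsto_id.sub tendsto_const_nhds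
    exact this.comp hsub
  have hsq : Tendsto (fun s : ℝ => ‖D.koopman s ψ - D.koopman t ψ‖ ^ 2) (𝓝 t) (𝓝 0) := by
    simp_rw [norm_koopman_sub_koopman_sq D _ t ψ]
    have := (tendsto_const_nhds (x := ⟪D.koopman 0 ψ, ψ⟫_ℝ)).sub h0
    rw [sub_self] at this
    simpa using this.const_mul 2
  have hnorm : Tendsto (fun s : ℝ => ‖D.koopman s ψ - D.koopman t ψ‖) (𝓝 t) (𝓝 0) := by
    have h := (Real.continuous_sqrt.tendsto 0).comp hsq
    rw [Real.sqrt_zero] at h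
    refine h.congr fun s => ?_
    simp only [Function.comp_apply, Real.sqrt_sq (norm_nonneg _)]
  rcases Metric.tendsto_nhds_nhds.1 hnorm ε hε with ⟨δ, hδ, H⟩
  refine ⟨δ, hδ, fun s hs => ?_⟩
  have := H hs
  rwa [Real.dist_eq, sub_zero, abs_of_nonneg (norm_nonneg _), ← dist_eq_norm] at this

end Orbit

/-- **C1 carries strong continuity of the Koopman orbit of the stress class** (the registered helper): for every
`F : HardSphereFluctuationData σ`, IF the stress autocorrelation is the cosine transform of an integrable density (the
content of stub C1 for that `F`), THEN it is continuous in `s` and `s ↦ U_s ξ_Π` is strongly continuous. [folklore] -/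
theorem stressSpectralDensity_consequences :
    ∀ (σ : ℝ) (F : HardSphereFluctuationData σ) (ρ : ℝ → ℝ), Integrable ρ →
      (∀ s : ℝ, ⟪F.koopman s (F.fluct (cellObs fun v : V3 => v 0 * v 1)),
          F.fluct (cellObs fun v : V3 => v 0 * v 1)⟫_ℝ = ∫ l, Real.cos (s * l) * ρ l) →
      (Continuous fun s : ℝ => ⟪F.koopman s (F.fluct (cellObs fun v : V3 => v 0 * v 1)),
          F.fluct (cellObs fun v : V3 => v 0 * v 1)⟫_ℝ) ∧
      Continuous fun s : ℝ => F.koopman s (F.fluct (cellObs fun v : V3 => v 0 * v 1)) := by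
  intro σ F ρ hρ hrepr
  refine ⟨?_, continuous_koopman_of_inner_eq_integral_cos F.toFluctuationDynamics _ hρ hrepr⟩
  have e : (fun s : ℝ => ⟪F.koopman s (F.fluct (cellObs fun v : V3 => v 0 * v 1)),
      F.fluct (cellObs fun v : V3 => v 0 * v 1)⟫_ℝ) = fun s => ∫ l, Real.cos (s * l) * ρ l := funext hrepr
  rw [e]
  exact continuous_integral_cos_mul hρ

end Summit.AtomisticToContinuum.HydrodynamicLimit.Theorems.MourreKoopmanChargesStressStrongMixing

end
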